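import Literature.Probability.RandomPlanarGeometry.HexSAWBrickWallStripFugacityWidthOneContactEntropyBinary
import HarnessLib

/-!
# The rung entropy is a binary entropy, and it is the maximum of the two-density contact entropy over its fibre (equipartition)

Child module of `…ContactEntropyBinary` (the two-density contact entropy `s(a,a') = a·H(ρ/2a) + a'·H(ρ/2a')`, `ρ = 1 − 2a − 2a'`) and of the
rung chapter of `…FugacityWidthOneContactLDP` §17–§18 (the rung entropy `s_V(ρ) = rungEntropy ρ = log m − ((1−ρ)/2) log(m³/(m+1))`,
`m = (1−3ρ)/(2ρ)`, the exponential growth rate of the number of strip walks with rung density `ρ`).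
* §1 ★★★ **`rungEntropy_eq_binEntropy`**: `s_V(ρ) = ((1−ρ)/2)·H(2ρ/(1−ρ))` for `0 < ρ < 1/3` — the rung entropy is ONE binary entropy:
  of the `(1−ρ)N/2` wall contacts of a walk with `ρN` rungs, which ones are followed by a rung.
* §2 ★★ **`rungEntropy_eq_contactEntropy₂_diag`**: `s_V(ρ) = s((1−ρ)/4, (1−ρ)/4)` — the rung entropy is the two-density entropy at the
  SYMMETRIC pair of its fibre `{a + a' = (1−ρ)/2}`.
* §3 ★★★ **EQUIPARTITION** (`contactEntropy₂_lt_rungEntropy`, `contactEntropy₂_le_rungEntropy`, `isGreatest_contactEntropy₂_fibre`): on the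
  fibre `a + a' = (1−ρ)/2` of the open triangle, `s(a,a') ≤ s_V(ρ)` with equality IFF `a = a'` — at a given rung density the entropy is
  maximised exactly when the two walls share the contacts equally (strict concavity of `s` + the swap symmetry); this is the contraction
  principle from the pair `(bc/N, tc/N)` to the rung density `V/N = 1 − 2·bc/N − 2·tc/N` at the level of the entropies.
* §4 ★★ `log_stripConnectiveConstant_one_eq_binEntropy(_cube)`: `log μ(S₁) = ((μ+1)/(2μ+3))·H(1/(μ+1)) = μ³·H(μ⁻³)/(2μ+3)` — the logarithm of
  the plastic number `μ = μ(S₁)` (`μ³ = μ+1`) is a binary entropy (the rung entropy at the typical rung density `1/(2μ+3)`, `rungEntropy_le`).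

## Sources
JansevanRensburg2000 §3.2–§3.3 (1st ed., OUP 2000: density functions, their Legendre structure and concavity); DemboZeitouni2010 §4.2.1
(contraction principle — here at the level of the explicit entropies); BeatonBousquetMelouDeGierDuminilCopinGuttmann2014 §3.2 (the strip `S_1`).  Nothing quoted AS PRINTED; the identities are this lineage's
(elementary algebra on the tree's closed forms `rungEntropy`, `contactEntropy₂_eq_binEntropy`).
-/

noncomputable section

open Filter Topology Finset Literature.Probability.LatticeModels Literature.Probability.Percolation SimpleGraph

namespace Literature.Probability.RandomPlanarGeometry.SAW.HexBW

open WidthOneYZ Real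

/-! ## §1 The rung entropy is a binary entropy -/

/-- ★★★ **`s_V(ρ) = ((1−ρ)/2)·H(2ρ/(1−ρ))`** for `0 < ρ < 1/3`, `H` the binary entropy (Mathlib `Real.binEntropy`): the rung entropy of the
one-cell strip is the entropy of choosing, among the `(1−ρ)N/2` wall contacts, the `ρN` that are followed by a rung.
[cite: JansevanRensburg2000, §3.2 Theorem 3.19 (1st ed., p. 52: the density function; lane statement — explicit for the strip)] -/
theorem rungEntropy_eq_binEntropy {ρ : ℝ} (hρ0 : 0 < ρ) (hρ : ρ < 1 / 3) :
    rungEntropy ρ = (1 - ρ) / 2 * binEntropy (2 * ρ / (1 - ρ)) := by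
  have h1 : (0 : ℝ) < 1 - 3 * ρ := by linarith
  have h2 : (0 : ℝ) < 2 * ρ := by linarith
  have h3 : (0 : ℝ) < 1 - ρ := by linarith
  have hm : rungM ρ = (1 - 3 * ρ) / (2 * ρ) := rfl
  have hm1 : rungM ρ + 1 = (1 - ρ) / (2 * ρ) := by rw [hm]; field_simp; ring
  have hY : rungY ρ = rungM ρ ^ 3 / (rungM ρ + 1) := rfl
  have hmpos : 0 < rungM ρ := by rw [hm]; positivity
  have lm : Real.log (rungM ρ) = Real.log (1 - 3 * ρ) - Real.log (2 * ρ) := by rw [hm, Real.log_div h1.ne' h2.ne']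
  have lm1 : Real.log (rungM ρ + 1) = Real.log (1 - ρ) - Real.log (2 * ρ) := by rw [hm1, Real.log_div h3.ne' h2.ne']
  have lY : Real.log (rungY ρ) = 3 * Real.log (rungM ρ) - Real.log (rungM ρ + 1) := by
    rw [hY, Real.log_div (pow_pos hmpos 3).ne' (by linarith), Real.log_pow]; push_cast; ring
  unfold rungEntropy
  rw [lY, lm, lm1]
  unfold binEntropy
  have e1 : 1 - 2 * ρ / (1 - ρ) = (1 - 3 * ρ) / (1 - ρ) := by field_simp; ring
  rw [e1, inv_div, inv_div, Real.log_div h3.ne' h2.ne', Real.log_div h3.ne' h1.ne']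
  field_simp
  ring

/-! ## §2 The rung entropy is the diagonal two-density entropy -/

/-- ★★ **`s_V(ρ) = s((1−ρ)/4, (1−ρ)/4)`** for `0 < ρ < 1/3`: the rung entropy equals the two-density contact entropy at the symmetric
density pair with rung density `ρ`. [cite: JansevanRensburg2000, §3.2 Theorem 3.19 (1st ed., p. 52; lane statement)] -/
theorem rungEntropy_eq_contactEntropy₂_diag {ρ : ℝ} (hρ0 : 0 < ρ) (hρ : ρ < 1 / 3) :
    rungEntropy ρ = contactEntropy₂ ((1 - ρ) / 4) ((1 - ρ) / 4) := by
  rw [rungEntropy_eq_binEntropy hρ0 hρ, contactEntropy₂_diag_binEntropy (by linarith) (by linarith)]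
  have e1 : (1 - 4 * ((1 - ρ) / 4)) / (2 * ((1 - ρ) / 4)) = 2 * ρ / (1 - ρ) := by
    have h3 : (1 : ℝ) - ρ ≠ 0 := by linarith
    field_simp; ring
  rw [e1]; ring

/-! ## §3 Equipartition: the rung entropy is the maximum of the two-density entropy over its fibre -/

/-- ★★★ **STRICT EQUIPARTITION**: for `(a,a')` in the open density triangle with `a ≠ a'`,
`s(a,a') < s_V(1 − 2a − 2a')` — an asymmetric sharing of the contacts between the walls costs entropy at fixed rung density
(strict concavity of `s` on the segment to the mirror pair `(a',a)`, whose midpoint is the symmetric pair, and `s(a',a) = s(a,a')`).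
[cite: JansevanRensburg2000, §3.3 (1st ed.: strict concavity of density functions; lane statement); DemboZeitouni2010, §4.2.1 (contraction principle)] -/
theorem contactEntropy₂_lt_rungEntropy {a a' : ℝ} (h1 : a + a' < 1 / 2) (h2 : 1 < 4 * a + 2 * a') (h3 : 1 < 2 * a + 4 * a')
    (hne : a ≠ a') : contactEntropy₂ a a' < rungEntropy (1 - 2 * a - 2 * a') := by
  have hρ0 : 0 < 1 - 2 * a - 2 * a' := by linarith
  have hρ : 1 - 2 * a - 2 * a' < 1 / 3 := by linarith
  rw [rungEntropy_eq_contactEntropy₂_diag hρ0 hρ]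
  have hsc := strictConcaveOn_contactEntropy₂
  have hx : ((a, a') : ℝ × ℝ) ∈ {p : ℝ × ℝ | p.1 + p.2 < 1 / 2 ∧ 1 < 4 * p.1 + 2 * p.2 ∧ 1 < 2 * p.1 + 4 * p.2} := ⟨h1, h2, h3⟩
  have hy : ((a', a) : ℝ × ℝ) ∈ {p : ℝ × ℝ | p.1 + p.2 < 1 / 2 ∧ 1 < 4 * p.1 + 2 * p.2 ∧ 1 < 2 * p.1 + 4 * p.2} :=
    ⟨by simp only; linarith, by simp only; linarith, by simp only; linarith⟩
  have hxy : ((a, a') : ℝ × ℝ) ≠ (a', a) := by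
    intro h; apply hne; exact (Prod.mk.inj h).1
  have key := hsc.2 hx hy hxy (show (0 : ℝ) < 1 / 2 by norm_num) (show (0 : ℝ) < 1 / 2 by norm_num)
    (show (1 / 2 : ℝ) + 1 / 2 = 1 by norm_num)
  have emid : (1 / 2 : ℝ) • ((a, a') : ℝ × ℝ) + (1 / 2 : ℝ) • ((a', a) : ℝ × ℝ) = ((1 - (1 - 2 * a - 2 * a')) / 4, (1 - (1 - 2 * a - 2 * a')) / 4) := by
    ext <;> simp [smul_eq_mul] <;> ring
  rw [emid] at key
  simp only [smul_eq_mul] at key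
  rw [contactEntropy₂_swap a a'] at key
  linarith

/-- ★★ **`s(a,a') ≤ s_V(1 − 2a − 2a')`** on the open density triangle, with equality iff `a = a'`.
[cite: JansevanRensburg2000, §3.3 (1st ed.; lane statement); DemboZeitouni2010, §4.2.1 (contraction principle)] -/
theorem contactEntropy₂_le_rungEntropy {a a' : ℝ} (h1 : a + a' < 1 / 2) (h2 : 1 < 4 * a + 2 * a') (h3 : 1 < 2 * a + 4 * a') :
    contactEntropy₂ a a' ≤ rungEntropy (1 - 2 * a - 2 * a') ∧
      (contactEntropy₂ a a' = rungEntropy (1 - 2 * a - 2 * a') ↔ a = a') := by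
  by_cases hne : a = a'
  · subst hne
    have e : rungEntropy (1 - 2 * a - 2 * a) = contactEntropy₂ a a := by
      rw [rungEntropy_eq_contactEntropy₂_diag (by linarith) (by linarith)]
      congr 1 <;> ring
    exact ⟨e.symm.le, ⟨fun _ => rfl, fun _ => e.symm⟩⟩
  · have hlt := contactEntropy₂_lt_rungEntropy h1 h2 h3 hne
    exact ⟨hlt.le, ⟨fun h => absurd h hlt.ne, fun h => absurd h hne⟩⟩

/-- ★★★ **THE CONTRACTION PRINCIPLE AT THE LEVEL OF ENTROPIES**: for `0 < ρ < 1/3`, the rung entropy `s_V(ρ)` is the GREATEST value of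
the two-density contact entropy `s(a,a')` over the fibre `{(a,a') ∈ T : a + a' = (1−ρ)/2}` of density pairs with rung density `ρ`, attained
at the symmetric pair (and, by `contactEntropy₂_le_rungEntropy`, only there).
[cite: DemboZeitouni2010, §4.2.1 Theorem 4.2.1 (contraction principle: the rate of the image is the infimum over fibres — here sup of entropies); JansevanRensburg2000, §3.2–§3.3 (1st ed.)] -/
theorem isGreatest_contactEntropy₂_fibre {ρ : ℝ} (hρ0 : 0 < ρ) (hρ : ρ < 1 / 3) :
    IsGreatest {s : ℝ | ∃ a a' : ℝ, a + a' < 1 / 2 ∧ 1 < 4 * a + 2 * a' ∧ 1 < 2 * a + 4 * a' ∧ 1 - 2 * a - 2 * a' = ρ ∧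
      s = contactEntropy₂ a a'} (rungEntropy ρ) := by
  refine ⟨⟨(1 - ρ) / 4, (1 - ρ) / 4, by linarith, by linarith, by linarith, by ring, rungEntropy_eq_contactEntropy₂_diag hρ0 hρ⟩, ?_⟩
  rintro s ⟨a, a', h1, h2, h3, hρa, rfl⟩
  rw [← hρa]
  exact (contactEntropy₂_le_rungEntropy h1 h2 h3).1

/-! ## §4 The logarithm of the plastic number is a binary entropy -/

/-- ★★ **`log μ(S₁) = ((μ+1)/(2μ+3))·H(1/(μ+1))`**, `μ = μ(S₁)` the connective constant of the one-cell strip (the plastic number,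
`μ³ = μ + 1`): the growth rate of the strip is the rung entropy at the typical rung density `ρ* = 1/(2μ+3)` (`rungEntropy_le`), which by §1
is one binary entropy. [cite: JansevanRensburg2000, §3.2 Theorem 3.19 (1st ed., p. 52; lane statement); BeatonBousquetMelouDeGierDuminilCopinGuttmann2014, §3.2 Proposition 6 (arXiv v5 p. 10: the strip `S_1`)] -/
theorem log_stripConnectiveConstant_one_eq_binEntropy :
    Real.log (stripConnectiveConstant 1) =
      (stripConnectiveConstant 1 + 1) / (2 * stripConnectiveConstant 1 + 3) * binEntropy (1 / (stripConnectiveConstant 1 + 1)) := by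
  set μ := stripConnectiveConstant 1 with hμ
  have hμ1 : (1.3247 : ℝ) < μ := stripConnectiveConstant_one_mem_Ioo.1
  have hρ0 : (0 : ℝ) < 1 / (2 * μ + 3) := by positivity
  have hρ : 1 / (2 * μ + 3) < 1 / 3 := by
    rw [div_lt_div_iff₀ (by positivity) (by norm_num)]; linarith
  have key := ((rungEntropy_le hρ0 hρ).2).2 rfl
  rw [← key, rungEntropy_eq_binEntropy hρ0 hρ]
  have h23 : (2 : ℝ) * μ + 3 ≠ 0 := by positivity
  have e1 : (1 - 1 / (2 * μ + 3)) / 2 = (μ + 1) / (2 * μ + 3) := by field_simp; ring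
  have e2 : 2 * (1 / (2 * μ + 3)) / (1 - 1 / (2 * μ + 3)) = 1 / (μ + 1) := by
    have hμ1' : (μ : ℝ) + 1 ≠ 0 := by positivity
    have h22 : (2 : ℝ) * μ + 2 ≠ 0 := by positivity
    rw [div_eq_div_iff (by
      rw [show (1 : ℝ) - 1 / (2 * μ + 3) = (2 * μ + 2) / (2 * μ + 3) by field_simp; ring]; positivity) hμ1']
    field_simp
    ring
  rw [e1, e2]

/-- ★★ The same in terms of the cubic law: **`log μ = μ³·H(μ⁻³)/(2μ+3)`** for the plastic number `μ = μ(S₁)` (`μ³ = μ + 1`).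
[cite: BeatonBousquetMelouDeGierDuminilCopinGuttmann2014, §3.2 Proposition 6 (arXiv v5 p. 10; lane statement)] -/
theorem log_stripConnectiveConstant_one_eq_binEntropy_cube :
    Real.log (stripConnectiveConstant 1) =
      stripConnectiveConstant 1 ^ 3 / (2 * stripConnectiveConstant 1 + 3) * binEntropy ((stripConnectiveConstant 1 ^ 3)⁻¹) := by
  rw [log_stripConnectiveConstant_one_eq_binEntropy, ← stripConnectiveConstant_one_pow_three, one_div]

end Literature.Probability.RandomPlanarGeometry.SAW.HexBW
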